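import Summits.QuantumFields.BalabanUV.T4Continuum.Support.ScalarBlockPoincareLocal
import Summits.QuantumFields.BalabanUV.T4Continuum.Support.NE7BoxReflection
import Summits.QuantumFields.BalabanUV.T4Continuum.Support.NE7FlatSliceSourceDuality
import Summits.QuantumFields.BalabanUV.T4Continuum.Support.NE3CoarseTorusExact
import Literature.MathematicalPhysics.QuantumFieldTheory.Balaban1983to89.MatrixNorms
import HarnessLib

/-!
# NE7 — THE DISCRETE POINCARÉ INEQUALITY ON THE BOX `[0, M)ᵈ ⊂ ℤᵈ` FOR MATRIX FIELDS, IN THE NORMALISED HILBERT–SCHMIDT SQUARE: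
# `Σ_{x ∈ box} ‖η(x) − η̄‖²_{HS}∕n ≤ (M(M−1)∕2)·Σ_{bonds (x, x+e_μ) ⊂ box} ‖η(x+e_μ) − η(x)‖²_{HS}∕n`, `η̄` the box mean (F311a)

Cell `pub-balaban`, rung (B)+1 sub-cell t4, lineage `b2b-balaban-t4-ne7-p1` (CRUX PROVER NE7 #1 = OWNER of row NE7), generation 93; memo
`t4/b2b-balaban-t4-ne7-p1-g93/UHLENBECK-ROAD.md` §3.  Over `ScalarBlockPoincareLocal.sum_norm_sub_mean_sq_le_cube` (the coordinate-cube Poincaré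
inequality for complex-valued functions, `d`-free constant `n(n+1)/2`; kernel: `Beta.CoordCubePoincare.poincare_coordCube`), read entrywise and
transported from the cube chart `Fin d → Fin M` to the period box `periodBox M ⊂ ℤᵈ` along `boxVec`.

WHY.  The second variation of the trace link functional (F310) is the lattice Dirichlet form of the direction `η` minus a commutator pairing
`Σ_b Re tr(X_b[η_y, δ_b])` of `η` with the bond differences `δ`; its mean-zero part is controlled by `‖η − η̄‖_{ℓ²} ≤ √C_P ‖δ‖_{ℓ²}` — this file —
with `C_P = M(M−1)/2`, which is what makes the convexity of the functional survive in the regime `M²ε ≪ 1` (road U-IM, F311b).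

WHAT ([folklore]; 0 def, 0 sorry): `boxVec_mem_periodBox`, `boxVec_add_e_mem_iff` (cube chart bookkeeping; `boxVec_stepUp` is `NE3CoarseTorusExact`'s), `sum_nhsNormSq_eq`
(the HS square of a field as an entrywise double sum), and **`poincare_periodBox_nhs`**.
HONEST FRAMING (page 1): elementary lattice analysis; nothing of Bałaban's asserted; NE7 NOT PROVED here; spine 0∕9; finite T⁴ rung (B)+1 — NOT infinite
volume, NOT mass gap, NOT `BetaPertH`, NOT Clay.  No `sorry`; axioms ⊆ {propext, Classical.choice, Quot.sound}.
-/

set_option autoImplicit false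

open scoped BigOperators Matrix
open Finset

namespace Summit.QuantumFields.BalabanUV.T4Continuum.NE7BoxPoincareMatrix

open Literature.MathematicalPhysics.QuantumFieldTheory.Balaban1983to89
open B7Prop1Explicit MatrixNorms
open T4AveragingDeficitWallBoundary (periodBox mem_periodBox)
open Beta.CoordCubePoincare (stepUp)
open ScalarBlockPoincareLocal (sum_norm_sub_mean_sq_le_cube)
open NE7BoxReflection (add_e_apply_ne)
open NE7FlatSliceSourceDuality (sum_periodBox_eq_sum_boxVec)
open NE3CoarseTorusExact (boxVec_stepUp)

noncomputable section

variable {d : ℕ}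

/-! ## §1 The cube chart of the period box -/

/-- `boxVec y ∈ periodBox M`. [folklore] -/
theorem boxVec_mem_periodBox {M : ℕ} (y : Fin d → Fin M) : boxVec M y ∈ periodBox (d := d) M :=
  mem_periodBox.2 fun κ => ⟨by simp [boxVec], by simp [boxVec]⟩

/-- `boxVec y + e_μ ∈ periodBox (m+1)` iff `y_μ` is not the last coordinate value. [folklore] -/
theorem boxVec_add_e_mem_iff {m : ℕ} (y : Fin d → Fin (m + 1)) (μ : Fin d) :
    boxVec (m + 1) y + e μ ∈ periodBox (d := d) (m + 1) ↔ y μ ≠ Fin.last m := by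
  rw [mem_periodBox]
  constructor
  · intro h hμ
    have h2 := (h μ).2
    simp only [Pi.add_apply, boxVec, e_apply, hμ, Fin.val_last] at h2
    push_cast at h2; omega
  · intro h κ
    by_cases hκ : κ = μ
    · subst hκ
      have hlt : (y κ : ℕ) < m := Fin.val_lt_last h
      simp only [Pi.add_apply, boxVec, e_apply]
      constructor
      · positivity
      · push_cast; omega
    · rw [add_e_apply_ne _ hκ]
      simp only [boxVec]
      exact ⟨by positivity, by exact_mod_cast (y κ).isLt⟩

/-! ## §2 The Poincaré inequality -/

variable {n : Type*} [Fintype n] [DecidableEq n] [Nonempty n]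

omit [DecidableEq n] [Nonempty n] in
/-- The normalised HS square of a field, summed over a finite set, as an entrywise double sum. [folklore] -/
theorem sum_nhsNormSq_eq {ι : Type*} (s : Finset ι) (G : ι → Matrix n n ℂ) :
    ∑ y ∈ s, nhsNormSq (G y) = (∑ i, ∑ j, ∑ y ∈ s, ‖G y i j‖ ^ 2) / Fintype.card n := by
  simp only [nhsNormSq, Finset.sum_div]
  rw [Finset.sum_comm]
  refine Finset.sum_congr rfl fun i _ => ?_
  rw [Finset.sum_comm]

omit [DecidableEq n] in
/-- **THE POINCARÉ INEQUALITY ON THE BOX FOR MATRIX FIELDS** (normalised Hilbert–Schmidt square): for every `m`, `d` and `η : ℤᵈ → M_n(ℂ)`,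
`Σ_{x ∈ periodBox (m+1)} ‖η x − η̄‖²_{HS}∕n ≤ (m(m+1)/2)·Σ_{x} Σ_μ 𝟙(x + e_μ ∈ box)·‖η(x+e_μ) − η x‖²_{HS}∕n`, with `η̄ = (m+1)^{−d}·Σ_{z ∈ box} η z`
the box mean.  The constant does not depend on `d` or on `n`. [folklore] -/
theorem poincare_periodBox_nhs (m : ℕ) (η : Site d → Matrix n n ℂ) :
    ∑ x ∈ periodBox (d := d) (m + 1), nhsNormSq (η x - (((m + 1 : ℕ) : ℂ) ^ d)⁻¹ • ∑ z ∈ periodBox (d := d) (m + 1), η z)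
      ≤ (m : ℝ) * (m + 1) / 2 * ∑ x ∈ periodBox (d := d) (m + 1), ∑ μ : Fin d,
          (if x + e μ ∈ periodBox (d := d) (m + 1) then nhsNormSq (η (x + e μ) - η x) else 0) := by
  have hcard : (0 : ℝ) < Fintype.card n := Nat.cast_pos.mpr Fintype.card_pos
  -- reindex the box by the cube chart
  rw [sum_periodBox_eq_sum_boxVec (m + 1),
    sum_periodBox_eq_sum_boxVec (m + 1) (f := fun x => ∑ μ : Fin d,
      (if x + e μ ∈ periodBox (d := d) (m + 1) then nhsNormSq (η (x + e μ) - η x) else 0)),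
    sum_periodBox_eq_sum_boxVec (m + 1) (f := η)]
  -- the entrywise scalar inequality
  set F : n → n → (Fin d → Fin (m + 1)) → ℂ := fun i j y => η (boxVec (m + 1) y) i j with hF
  have hcardY : (Fintype.card (Fin d → Fin (m + 1)) : ℂ) = ((m + 1 : ℕ) : ℂ) ^ d := by
    rw [Fintype.card_fun, Fintype.card_fin, Fintype.card_fin]; push_cast; ring
  have hentry : ∀ i j : n, ∑ y, ‖(η (boxVec (m + 1) y) - (((m + 1 : ℕ) : ℂ) ^ d)⁻¹ • ∑ z, η (boxVec (m + 1) z)) i j‖ ^ 2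
      ≤ (m : ℝ) * (m + 1) / 2 * ∑ μ : Fin d, ∑ y ∈ univ.filter (fun y : Fin d → Fin (m + 1) => y μ ≠ Fin.last m),
          ‖F i j (stepUp y μ) - F i j y‖ ^ 2 := by
    intro i j
    have h := sum_norm_sub_mean_sq_le_cube m d (F i j)
    have hlhs : ∀ y, (η (boxVec (m + 1) y) - (((m + 1 : ℕ) : ℂ) ^ d)⁻¹ • ∑ z, η (boxVec (m + 1) z)) i j
        = F i j y - (∑ z, F i j z) / (Fintype.card (Fin d → Fin (m + 1)) : ℂ) := by
      intro y
      rw [hcardY, Matrix.sub_apply, Matrix.smul_apply, Matrix.sum_apply, smul_eq_mul, div_eq_inv_mul]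
    simp only [hlhs]
    exact h
  -- sum over the entries
  have hL : ∑ y, nhsNormSq (η (boxVec (m + 1) y) - (((m + 1 : ℕ) : ℂ) ^ d)⁻¹ • ∑ z, η (boxVec (m + 1) z))
      = (∑ i, ∑ j, ∑ y, ‖(η (boxVec (m + 1) y) - (((m + 1 : ℕ) : ℂ) ^ d)⁻¹ • ∑ z, η (boxVec (m + 1) z)) i j‖ ^ 2) / Fintype.card n :=
    sum_nhsNormSq_eq _ _
  have hR : ∑ y, ∑ μ : Fin d, (if boxVec (m + 1) y + e μ ∈ periodBox (d := d) (m + 1)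
        then nhsNormSq (η (boxVec (m + 1) y + e μ) - η (boxVec (m + 1) y)) else 0)
      = (∑ i, ∑ j, ∑ μ : Fin d, ∑ y ∈ univ.filter (fun y : Fin d → Fin (m + 1) => y μ ≠ Fin.last m),
          ‖F i j (stepUp y μ) - F i j y‖ ^ 2) / Fintype.card n := by
    -- rewrite the indicator through the cube chart
    have h1 : ∀ (y : Fin d → Fin (m + 1)) (μ : Fin d), (if boxVec (m + 1) y + e μ ∈ periodBox (d := d) (m + 1)
        then nhsNormSq (η (boxVec (m + 1) y + e μ) - η (boxVec (m + 1) y)) else 0)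
        = if y μ ≠ Fin.last m then nhsNormSq (η (boxVec (m + 1) (stepUp y μ)) - η (boxVec (m + 1) y)) else 0 := by
      intro y μ
      by_cases hy : y μ ≠ Fin.last m
      · rw [if_pos ((boxVec_add_e_mem_iff y μ).2 hy), if_pos hy, boxVec_stepUp y μ hy]
      · rw [if_neg (fun h => hy ((boxVec_add_e_mem_iff y μ).1 h)), if_neg hy]
    simp only [h1]
    rw [Finset.sum_comm]
    simp only [← Finset.sum_filter, sum_nhsNormSq_eq, Finset.sum_div]
    rw [Finset.sum_comm]
    refine Finset.sum_congr rfl fun i _ => ?_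
    rw [Finset.sum_comm]
    refine Finset.sum_congr rfl fun j _ => ?_
    refine Finset.sum_congr rfl fun μ _ => ?_
    refine Finset.sum_congr rfl fun y _ => ?_
    simp only [hF, Matrix.sub_apply]
  rw [hL, hR, mul_div_assoc', div_le_div_iff_of_pos_right hcard, Finset.mul_sum]
  refine Finset.sum_le_sum fun i _ => ?_
  rw [Finset.mul_sum]
  exact Finset.sum_le_sum fun j _ => hentry i j

end

end Summit.QuantumFields.BalabanUV.T4Continuum.NE7BoxPoincareMatrix
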